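import Summits.ValiantsHypothesis.ValiantsHypothesis.Theorems.LacunarySymmetroidMatrixDescartesCensusChamber1210NegLeaf
import Summits.ValiantsHypothesis.ValiantsHypothesis.Theorems.LacunarySymmetroidMatrixDescartesCensusChamber1210PosLeaf
import Summits.ValiantsHypothesis.ValiantsHypothesis.Theorems.LacunarySymmetroidMatrixDescartesCensusChamberHalves

/-!
# `MatrixDescartes` census — chamber 1210: complete door-A row from a DOMINATION leaf and an NFLOW v4 leaf

HONEST FRAMING.  Object-search cell `pub-symmetroid`, door-A target `DoorA26 := PosRootLawAt 2 6 19`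
(stmt-ValiantsHypothesis-19979; OPEN, typed, never asserted), crux `Theses.LacunarySymmetroid.MatrixDescartes`
(stmt-ValiantsHypothesis-18050).  Chamber 1210 of theory g6's table (smallest member `(0,12,17,26,33,39)`, mirror 2376;
words `DIIDDD` / `IDDIII`) has BOTH orientations alive at sign level: orientation `s = −` is killed for EVERY exponent
vector of the chamber by a chamber-uniform single-monomial DOMINATION leaf (`no_twenty_on_chamber1210_neg` on `G3(1,2,5)`, val-sym-door-p2 g6, kit j279642),
orientation `s = +` by val-sym-door-p2 g3's NFLOW v4 certificate (`no_twenty_on_chamber1210_pos`: geometry rows G3[145]qi>qj,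
order-only transport; data nflow_v4_certs_all.jsonl, generator gen4.py), and `Census.posRootLawOn_of_chamber_halves` (the case `det S_0 = 0` is
Descartes) assembles the complete row **`doorA26_on_chamber1210` — `PosRootLawOn 2 6 19 d` for EVERY `d` in the chamber**.  Nothing here
bears on `V = 19`, on other chambers, on `DoorA26` as a whole (OPEN), on the crux, or on `VP ≠ VNP`.

[folklore] Kernel assembly of two exact certificates (generated by the seat's `gen7mix.py`); elementary.
-/

-- `Summit.ValiantsHypothesis.ValiantsHypothesis.…` repeats a component by the D-0017 layout
-- (single-conjunct summit), which the `dupNamespace` linter flags; the name is mandated.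
set_option linter.dupNamespace false

namespace Summit.ValiantsHypothesis.ValiantsHypothesis.Theorems.LacunarySymmetroidMatrixDescartes.Census

open Polynomial Finset
open scoped BigOperators Polynomial Matrix

/-- **DOOR-A ROW ON THE WHOLE CHAMBER 1210**: every exponent vector whose pair sums are ordered as in chamber 1210 (smallest member
`(0,12,17,26,33,39)`) satisfies `ζ(2,6; d) ≤ 19` — one orientation by a domination leaf, the other by an NFLOW v4 leaf. [folklore] -/
theorem doorA26_on_chamber1210 (d : Fin 6 → ℕ)
    (hd : StrictMono ((fun p : Fin 6 × Fin 6 => d p.1 + d p.2) ∘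
      ![(0, 0), (0, 1), (0, 2), (1, 1), (0, 3), (1, 2), (0, 4), (2, 2), (1, 3), (0, 5), (2, 3),
        (1, 4), (2, 4), (1, 5), (3, 3), (2, 5), (3, 4), (3, 5), (4, 4), (4, 5), (5, 5)])) :
    PosRootLawOn 2 6 19 d :=
  posRootLawOn_of_chamber_halves _ 0 (by decide) (by decide) d hd
    (fun S hS hZ hs => no_twenty_on_chamber1210_pos d hd S hS hZ hs)
    (fun S hS hZ hs => no_twenty_on_chamber1210_neg d hd S hS hZ hs)

/-- Non-vacuity: the smallest member of chamber 1210. [folklore] -/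
example : PosRootLawOn 2 6 19 (![0, 12, 17, 26, 33, 39] : Fin 6 → ℕ) :=
  doorA26_on_chamber1210 _ (Fin.strictMono_iff_lt_succ.2 (by decide))

end Summit.ValiantsHypothesis.ValiantsHypothesis.Theorems.LacunarySymmetroidMatrixDescartes.Census
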